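/-
Copyright (c) 2026 the pub-hodgecm-mathlib formalisation cell (harness21).  Prover seat hodgecm-mathlib-LH4-p09 (g2), req620 Track A «(D-RAM) FOUR-FRAME» squad
(heir LEAD F0P3a-plan lineage; dealer LH4-plan lineage WORD #14; MS ROAD A, Stage B ∕ B9: the TYPE-2 POLARISATION CLASSES of the glued stratum — EVIDENCE FILE).  2026-09-04.
-/
import Summits.HodgeConjecture.HodgeConjecture.Theorems.F0P3cDyRamDiagonalGluedTubeCriterionTypeTwo    -- B5₂ (i) (this seat): `isVertexLattice_two_latt_hnf_glued_explicit` (the explicit fixed form `D(f)`)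
import Summits.HodgeConjecture.HodgeConjecture.Theorems.F0P3cDyRamDiagonalGluedStabiliserIndexCorner  -- ★ p856076 (F0P3-p01 (g31)): `mem_latticeStabilizer_latt_glued_corner_iff` (the e₃-axis bound `|u₂ − u₁| ≤ |ϖ|^{ρ+s+e}`)
import HarnessLib

/-!
# Crux `H413`, MS ROAD A, STAGE B ∕ B9: «TWO STABILISER-UNRELATED TYPE-2 POLARISATIONS ON THE EVEN-`ρ` GLUED STRATUM»

Cell `hodgecm-mathlib` (D-0151), FLOOR 0, crux item H413 = `stmt-HodgeConjecture-24833`; lane `--supports stmt-HodgeConjecture-24833 --as helper` (count-neutral).  THEOREMS ONLY.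
EVIDENCE for the squad's type-2 bookkeeping (LH4-p09 (g2) FLAG 2026-09-04T00:42:58Z; F0P3-p01 (g31) ★ p856076 FLAG; LH4-p10 (g2) MEMO v2.1 §T2.3 «parity ghost»):
the uniqueness socket «UNIQ₂» of the B9-0₂ assembly (`F0P3cDyRamDiagonalPolarisationCosetTwo`, `F0P3cDyRamStableModelSumOfStageB`'s binder `huniq₂`) asks that any two
type-2 polarisations `D, D′` (fixed non-degenerate diagonal forms for which `M` is a type-2 vertex) of a lattice `M ∈ 𝓛₀(T)` differ by an element of the fixed unit
stabiliser `S_F(M)`.  On the glued stratum `G₁(2ρ+1, s)` (`s` even) this holds for ODD `ρ` but FAILS FOR EVEN `ρ ≥ 2`: with the explicit form `D(f)` of B5₂ (i) §3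
(`D₂ = P`, `D₁ = −P(Nζ + f)`) the (R)-parameter `f` is free modulo `F ∩ 𝔭^{ρ+s}`, and for `ρ + s` even `f′ := f + π₀^{(ρ+s)∕2}` is again an (R)-parameter; the quotient
`u = D(f′)∕D(f)` has `u₂ = 1`, `u₁ = (Nζ + f′)∕(Nζ + f)`, so `|u₂ − u₁| = |ϖ|^{ρ+s}` EXCEEDS the `e₃`-axis bound `|u₂ − u₁| ≤ |ϖ|^{ρ+s+1}` that every element of the stabiliser
of `latt (1 0 0; x ϖ^ρ 0; xζ+y″ ϖ^ρζ ϖ^{2ρ+1+s})` obeys (★ p856076 `mem_latticeStabilizer_latt_glued_corner_iff` at `e = 1`).  Hence the polarisation set of such a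
lattice consists of (at least — in fact exactly) `q` cosets of `S_F`, and the type-2 model sum counts each such lattice with multiplicity `n₂ = q` (numerically: LH4-p10's engine
`finite_engine2.run_type2`, `cnt(ρ, s) = 2` at `(2,2), (2,4), (4,2)` and `1` at odd `ρ`, `F0/P3c/LH4/LH4-p09/g2/oracle/CNT-type2-cosets.txt`).
* `criterionR_add_of_even` — `f′ = f + π₀^{(ρ+s)∕2}` is again an (R)-parameter when `ρ + s` is even.
* **`exists_two_polarisations_not_stabiliser_related`** — the witness: two fixed type-2 polarisations `D, D′` of the glued frame with `¬ ∃ u ∈ S_F(latt V), D′ = D·u`.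
HONEST LABEL.  Count-neutral evidence about the INTERNAL `tv = 2` bookkeeping of the (MS) helper lane (which quantity Stage A₂∕B₂ must carry: `Σ_N n₂(N)·w(N)`, not
`Σ_{N polarisable} w(N)`); the census laws stay PROVER TARGETS; `HC_CM` is proved only modulo the 7 printed citations (2 remaining named inputs: hLiu418 = `stmt-HodgeConjecture-24832`,
h413 = `stmt-HodgeConjecture-24833`) until rung 0 closes.

## References
* [Jacobowitz1962] R. Jacobowitz, *Hermitian forms over local fields*, Amer. J. Math. 84 (1962), §7 (modular lattices and their Gram matrices).
* [Kottwitz1986BaseChangeUnits] R. Kottwitz, *Base change for unit elements of Hecke algebras*, Compositio Math. 60 (1986), §1 pp. 240–241 (fixed-lattice counting, torus stabilisers).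
-/

set_option autoImplicit false

noncomputable section

namespace Summit.HodgeConjecture.HodgeConjecture.Cruxes.H413.F0P3cDyRamDiagonalGluedTwoPolarisationsTypeTwo

open Matrix
open Literature.NumberTheory.Automorphic Literature.NumberTheory.Automorphic.HermitianLattice Literature.NumberTheory.Automorphic.UnitaryGroup
open Literature.NumberTheory.Automorphic.UnitaryLatticeTree
open Summit.HodgeConjecture.HodgeConjecture.Cruxes.H413.F0P3cDyRamDiagonalTorusDefs
open Summit.HodgeConjecture.HodgeConjecture.Cruxes.H413.F0P3cDyRamDiagonalGluedTubeCriterionTypeTwo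
open Summit.HodgeConjecture.HodgeConjecture.Cruxes.H413.F0P3cDyRamDiagonalGluedStabiliserIndexCorner
open scoped Valued WithZero Matrix MatrixGroups

variable {K : Type*} [Field K] [Valued K ℤᵐ⁰]

/-- **SHIFTING THE (R)-PARAMETER** (`ρ + s` even): if `|ζσy″ − σx·f| ≤ |ϖ|^{ρ+s}` with `|x| = 1` then the same holds for `f′ = f + (ϖσϖ)^{(ρ+s)∕2}`, which is again `σ`-fixed.
[cite: Kottwitz1986BaseChangeUnits, §1 pp. 240–241] -/
theorem criterionR_add_of_even {σ : K →+* K} (hσ : ∀ a, σ (σ a) = a) (hvσ : ∀ a, Valued.v (σ a) = Valued.v a) (ϖ : K) (ρ s : ℕ) (he : 2 ∣ ρ + s)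
    {x ζ y'' : K} (hx : Valued.v x = 1) {f : K} (hf : σ f = f) (hR : Valued.v (ζ * σ y'' - σ x * f) ≤ Valued.v ϖ ^ (ρ + s)) :
    σ (f + (ϖ * σ ϖ) ^ ((ρ + s) / 2)) = f + (ϖ * σ ϖ) ^ ((ρ + s) / 2) ∧
      Valued.v (ζ * σ y'' - σ x * (f + (ϖ * σ ϖ) ^ ((ρ + s) / 2))) ≤ Valued.v ϖ ^ (ρ + s) := by
  obtain ⟨m, hm⟩ := he
  have hm2 : (ρ + s) / 2 = m := by omega
  refine ⟨by rw [map_add, map_pow, map_mul, hσ, hf, mul_comm (σ ϖ) ϖ], ?_⟩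
  have hvπ : Valued.v ((ϖ * σ ϖ) ^ ((ρ + s) / 2)) = Valued.v ϖ ^ (ρ + s) := by
    rw [hm2, map_pow, map_mul, hvσ, ← sq, ← pow_mul, hm]
  rw [show ζ * σ y'' - σ x * (f + (ϖ * σ ϖ) ^ ((ρ + s) / 2)) = (ζ * σ y'' - σ x * f) - σ x * (ϖ * σ ϖ) ^ ((ρ + s) / 2) by ring]
  refine (Valuation.map_sub _ _ _).trans (max_le hR ?_)
  rw [map_mul, hvσ, hx, one_mul, hvπ]

/-- **TWO STABILISER-UNRELATED TYPE-2 POLARISATIONS** on the glued frame `V = (1 0 0; x ϖ^ρ 0; xζ+y″ ϖ^ρζ ϖ^{2ρ+1+s})` (`|x| = |ζ| = 1`, `|y″| = |ϖ|^s`, `ρ ≥ 1`,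
`ρ` and `s` EVEN, (R) with parameter `f`): the explicit forms `D = D(f)` and `D′ = D(f + π₀^{(ρ+s)∕2})` of B5₂ (i) §3 are both fixed type-2 polarisations of `latt V`, and NO
`u` in the fixed unit stabiliser `S_F(latt V)` has `D′ = D·u` — since `u₂ = 1`, `u₁ = (Nζ+f′)∕(Nζ+f)` would force `|ϖ|^{ρ+s} = |u₂ − u₁| ≤ |ϖ|^{ρ+s+1}`.  So «UNIQ₂» fails on
the even-`ρ` glued strata: their lattices carry `q` polarisation classes, not one. [cite: Jacobowitz1962, §7] [cite: Kottwitz1986BaseChangeUnits, §1 pp. 240–241] -/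
theorem exists_two_polarisations_not_stabiliser_related {σ : K →+* K} (hσ : ∀ a, σ (σ a) = a) (hvσ : ∀ a, Valued.v (σ a) = Valued.v a)
    {ϖ : K} (hϖ0 : ϖ ≠ 0) (hϖ1 : Valued.v ϖ < 1) (hTr : ∀ a : K, Valued.v (a + σ a) ≤ Valued.v ϖ * Valued.v a)
    (ρ s : ℕ) (hρ : 1 ≤ ρ) (hρ2 : 2 ∣ ρ) (hs2 : 2 ∣ s) (hs : 1 ≤ s) {x ζ y'' : K} (hx : Valued.v x = 1) (hζ : Valued.v ζ = 1) (hy'' : Valued.v y'' = Valued.v ϖ ^ s)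
    (V : GL (Fin 3) K) (hV : (V : Matrix (Fin 3) (Fin 3) K) = !![1, 0, 0; x, ϖ ^ ρ, 0; x * ζ + y'', ϖ ^ ρ * ζ, ϖ ^ (2 * ρ + 1 + s)])
    {f : K} (hf : σ f = f) (hR : Valued.v (ζ * σ y'' - σ x * f) ≤ Valued.v ϖ ^ (ρ + s)) :
    ∃ D D' : Fin 3 → K, ((∀ i, σ (D i) = D i ∧ D i ≠ 0) ∧ IsVertexLattice σ ϖ (Matrix.diagonal D) 2 (latt (V : Matrix (Fin 3) (Fin 3) K))) ∧
      ((∀ i, σ (D' i) = D' i ∧ D' i ≠ 0) ∧ IsVertexLattice σ ϖ (Matrix.diagonal D') 2 (latt (V : Matrix (Fin 3) (Fin 3) K))) ∧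
      ¬ ∃ u ∈ fixedUnitStabilizer σ (latt (V : Matrix (Fin 3) (Fin 3) K)), ∀ i, D' i = D i * ((u i : Kˣ) : K) := by
  have he : 2 ∣ ρ + s := (Nat.dvd_add_right hρ2).2 hs2
  obtain ⟨hf', hR'⟩ := criterionR_add_of_even hσ hvσ ϖ ρ s he hx hf hR
  set π : K := (ϖ * σ ϖ) ^ ((ρ + s) / 2) with hπ
  set P : K := ((ϖ * σ ϖ) ^ (ρ + s / 2))⁻¹ with hP
  set Nζ : K := ζ * σ ζ with hNζ
  -- the two explicit forms
  obtain ⟨hD, hDv⟩ := isVertexLattice_two_latt_hnf_glued_explicit hσ hvσ hϖ0 hϖ1 hTr ρ s hρ hs2 hs hx hζ hy'' V hV hf hR hP rfl rfl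
  obtain ⟨hD', hD'v⟩ := isVertexLattice_two_latt_hnf_glued_explicit hσ hvσ hϖ0 hϖ1 hTr ρ s hρ hs2 hs hx hζ hy'' V hV hf' hR' hP rfl rfl
  refine ⟨_, _, ⟨hD, hDv⟩, ⟨hD', hD'v⟩, ?_⟩
  rintro ⟨u, hu, hDu⟩
  rw [mem_fixedUnitStabilizer_iff] at hu
  obtain ⟨hstab, hunit, -⟩ := hu
  -- valuations: `|f| < 1 = |Nζ|`, so `Nζ + f ≠ 0`; `|π| = |ϖ|^{ρ+s}`
  have hvϖ : 0 < Valued.v ϖ := (Valuation.pos_iff _).2 hϖ0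
  have h1 : Valued.v (ζ * σ y'') = Valued.v ϖ ^ s := by rw [map_mul, hζ, hvσ, hy'', one_mul]
  have hlt : Valued.v (ζ * σ y'' - σ x * f) < Valued.v (ζ * σ y'') :=
    hR.trans_lt (by rw [h1]; exact pow_lt_pow_right_of_lt_one₀ hvϖ hϖ1 (by omega))
  have hvxf : Valued.v (σ x * f) = Valued.v (ζ * σ y'') := by
    have e : σ x * f = ζ * σ y'' + -(ζ * σ y'' - σ x * f) := by ring
    rw [e]; exact Valuation.map_add_eq_of_lt_left _ (by rwa [Valuation.map_neg])
  have hvf : Valued.v f = Valued.v ϖ ^ s := by rw [map_mul, hvσ, hx, one_mul] at hvxf; exact hvxf.trans h1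
  have hfv : Valued.v f < 1 := by rw [hvf]; exact pow_lt_one₀ zero_le hϖ1 (by omega)
  have hvNζ : Valued.v Nζ = 1 := by rw [hNζ, map_mul, hvσ, hζ, one_mul]
  have hvNf : Valued.v (Nζ + f) = 1 := by rw [Valuation.map_add_eq_of_lt_left _ (by rw [hvNζ]; exact hfv), hvNζ]
  have hNf0 : Nζ + f ≠ 0 := fun h => by rw [h, map_zero] at hvNf; exact zero_ne_one hvNf
  have hP0 : P ≠ 0 := by
    rw [hP]; refine inv_ne_zero (pow_ne_zero _ (mul_ne_zero hϖ0 fun h => hϖ0 ?_)); rw [← hσ ϖ, h, map_zero]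
  obtain ⟨m, hm⟩ := he
  have hvπ : Valued.v π = Valued.v ϖ ^ (ρ + s) := by
    rw [hπ, show (ρ + s) / 2 = m by omega, map_pow, map_mul, hvσ, ← sq, ← pow_mul, hm]
  -- `u₂ = 1` and `u₁ = (Nζ + f′)∕(Nζ + f)`
  have h2 := hDu 2
  have h1' := hDu 1
  simp only [Matrix.cons_val_two, Matrix.tail_cons, Matrix.head_cons, Matrix.cons_val_one] at h2 h1'
  have hu2 : ((u 2 : Kˣ) : K) = 1 := by
    have : P * ((u 2 : Kˣ) : K) = P * 1 := by rw [mul_one]; exact h2.symm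
    exact mul_left_cancel₀ hP0 this
  have hu1 : ((u 1 : Kˣ) : K) * (Nζ + f) = Nζ + (f + π) := by
    have e : -(P * (Nζ + (f + π))) = -(P * (Nζ + f)) * ((u 1 : Kˣ) : K) := h1'
    have e2 : P * (((u 1 : Kˣ) : K) * (Nζ + f)) = P * (Nζ + (f + π)) := by linear_combination e
    exact mul_left_cancel₀ hP0 e2
  -- the `e₃`-axis bound from the stabiliser
  have hV' : (V : Matrix (Fin 3) (Fin 3) K) = !![1, 0, 0; x, ϖ ^ ρ, 0; x * ζ + y'', ϖ ^ ρ * ζ, ϖ ^ (2 * ρ + s + 1)] := by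
    rw [hV, show 2 * ρ + 1 + s = 2 * ρ + s + 1 by ring]
  have hmem : u ∈ latticeStabilizer (latt (V : Matrix (Fin 3) (Fin 3) K)) := (mem_latticeStabilizer_iff _ _).2 hstab
  obtain ⟨-, hb, -⟩ := (mem_latticeStabilizer_latt_glued_corner_iff hϖ0 ρ s 1 hx hζ V hV' u hunit).1 hmem
  -- `u₂ − u₁ = −π∕(Nζ + f)` has valuation `|ϖ|^{ρ+s}`
  have hdiff : ((u 2 : Kˣ) : K) - u 1 = -(π / (Nζ + f)) := by
    rw [hu2, ← neg_div, eq_div_iff hNf0]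
    linear_combination -hu1
  rw [hdiff, Valuation.map_neg, map_div₀, hvπ, hvNf, div_one, pow_succ] at hb
  have : (1 : ℤᵐ⁰) ≤ Valued.v ϖ := le_of_mul_le_mul_left (by rwa [mul_one]) (pow_pos hvϖ _)
  exact absurd hϖ1 (not_lt.2 this)

end Summit.HodgeConjecture.HodgeConjecture.Cruxes.H413.F0P3cDyRamDiagonalGluedTwoPolarisationsTypeTwo

end
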